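import Summits.Ventures.PercRepro.C041TriDomSharingS1
import Summits.Ventures.PercRepro.C041TriDomMarkEdges
import Summits.Ventures.PercRepro.C041TriDomGlueInduction

/-!
# ROW C-041 — THEOREM (ONE MARK EDGE): A HOST WITH AN EDGE AMONG ITS MARKS SATISFIES THE CONJECTURE
(p6, gen 48; P6-TWOEXIT-LEAN.md §53 ADDENDUM 22 cont.)

CONJECTURE (STOCHASTIC DOMINATION) (`CycDominationS`: on every up-set the cyclic crossed classes `(s₁,s₂) ∪ (s₂,s₃) ∪
(s₃,s₁)` are outnumbered by `(⊤,⊥)`) holds on every status of every finite host with a PRESENT edge joining two of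
its marks (`cycDominationS_of_markEdge`; all-free `cycDomination_of_markEdge`).  PROOF.  A double mark edge joins its
ends in both colours and empties every crossed class (`cycDominationS_of_double_edge_xy`).  For a FREE edge `e = xy`
the count of the functional `CycF = 1_{(⊤,⊥)} − 1_{crossed}` over an up-set `V` is sliced at `e` (`cntF_rec`):
`2·Σ_V CycF = Σ_{V_R} CycF(σ ∨ xy, τ) + Σ_{V_B} CycF(σ, τ ∨ xy)`, where `(σ, τ)` are the patterns of the deletion
`st[e := absent]` and `∨ xy` joins `x` and `y` (`joinXY`; `rsig_double_join_xy`, `bsig_double_join_xy`, from the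
full one-edge lemma `rtg_add_edge_iff`).  The blue-`e` summands are `≤ 0` (`cycF_nonpos_of_blue_xy`: `x ~_B y`
kills `(⊤,⊥)`), so the worst case is `V_B = V_R`, and pointwise `CycF(σ ∨ xy, τ) + CycF(σ, τ ∨ xy) ≥ S1F(σ, τ)`
(`S1F_le_cycF_join`: the left-hand side is the one-mark-edge functional `C_xy` of ADDENDUM 20, which exceeds the
sharing functional by the class `(s₃,s₂)`).  Hence `2·Σ_V CycF ≥ Σ_{V_R} S1F = cntS1 (st[e := absent]) V_R ≥ 0` by
THEOREM (THE ASYMMETRIC SHARING S1) (`cntS1_nonneg`).  The other two mark pairs follow by the rotation of the marks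
(`cycDominationS_rot`).  With THEOREM (TWO MARK EDGES) the open core of the conjecture now has NO edge among its marks.
-/

namespace PercRepro

namespace ZoneZ

namespace MultiExit

open ZoneData Finset

variable {V₁ E₁ U₁ U₂ : Type} (Z₁ : ZoneData V₁ E₁ U₁ U₂) (u u' a₁ : V₁)

/-! ## The functional of the conjecture and the join of two marks -/

/-- The functional of CONJECTURE (STOCHASTIC DOMINATION) in the coordinates `(x ~ y, x ~ z, y ~ z)`: `+1` on `(⊤,⊥)`,
`−1` on the cyclic crossed classes `(s₁,s₂)`, `(s₂,s₃)`, `(s₃,s₁)`. -/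
def CycF (s t : P3) : ℤ :=
  (if s = (true, true, true) ∧ t = (false, false, false) then 1 else 0)
    - (if (s = (true, false, false) ∧ t = (false, true, false)) ∨
          (s = (false, true, false) ∧ t = (false, false, true)) ∨
          (s = (false, false, true) ∧ t = (true, false, false)) then 1 else 0)

/-- Joining `x` and `y` in a pattern: `x ~ y`, and `z` is joined to both if it was joined to either. -/
def joinXY (s : P3) : P3 := (true, s.2.1 || s.2.2, s.2.1 || s.2.2)

/-- With `x ~_B y` the functional of the conjecture is never positive. -/
theorem cycF_nonpos_of_blue_xy : ∀ s t : P3, t.1 = true → CycF s t ≤ 0 := by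
  decide

/-- **The mark-edge split, pointwise**: the functional of the conjecture at the two colours of a mark edge `xy`
dominates the sharing functional of the host without the edge. -/
theorem S1F_le_cycF_join : ∀ s t : P3, Trans3 s → Trans3 t →
    S1F s t ≤ CycF (joinXY s) t + CycF s (joinXY t) := by
  decide

/-! ## The full one-edge lemma -/

/-- **The one-edge lemma**: a walk that may use the edge `f` either avoids it or passes through it once, in one of
the two directions. -/
theorem rtg_add_edge_iff {R : V₁ → V₁ → Prop} (f : E₁) (a b : V₁) :
    Relation.ReflTransGen (fun x y => R x y ∨ Z₁.Joins f x y) a b ↔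
      Relation.ReflTransGen R a b ∨
        (Relation.ReflTransGen R a (Z₁.fst f) ∧ Relation.ReflTransGen R (Z₁.snd f) b) ∨
        (Relation.ReflTransGen R a (Z₁.snd f) ∧ Relation.ReflTransGen R (Z₁.fst f) b) := by
  constructor
  · intro h
    induction h with
    | refl => exact Or.inl Relation.ReflTransGen.refl
    | tail _ hcb ih =>
      rcases hcb with hcb | hcb
      · rcases ih with ih | ⟨ih1, ih2⟩ | ⟨ih1, ih2⟩
        · exact Or.inl (ih.tail hcb)
        · exact Or.inr (Or.inl ⟨ih1, ih2.tail hcb⟩)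
        · exact Or.inr (Or.inr ⟨ih1, ih2.tail hcb⟩)
      · rcases hcb with ⟨h1, h2⟩ | ⟨h1, h2⟩
        · rcases ih with ih | ⟨ih1, _⟩ | ⟨ih1, _⟩
          · refine Or.inr (Or.inl ⟨?_, ?_⟩)
            · rw [h1]; exact ih
            · rw [h2]
          · refine Or.inr (Or.inl ⟨ih1, ?_⟩)
            rw [h2]
          · left
            rw [h2] at ih1
            exact ih1
        · rcases ih with ih | ⟨ih1, _⟩ | ⟨ih1, _⟩
          · refine Or.inr (Or.inr ⟨?_, ?_⟩)
            · rw [h2]; exact ih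
            · rw [h1]
          · left
            rw [h1] at ih1
            exact ih1
          · refine Or.inr (Or.inr ⟨ih1, ?_⟩)
            rw [h1]
  · rintro (h | ⟨h1, h2⟩ | ⟨h1, h2⟩)
    · exact Relation.ReflTransGen.mono (fun x y hxy => Or.inl hxy) a b h
    · have hpq : Relation.ReflTransGen (fun x y => R x y ∨ Z₁.Joins f x y) (Z₁.fst f) (Z₁.snd f) :=
        Relation.ReflTransGen.single (Or.inr (Or.inl ⟨rfl, rfl⟩))
      exact ((Relation.ReflTransGen.mono (fun x y hxy => Or.inl hxy) _ _ h1).trans hpq).trans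
        (Relation.ReflTransGen.mono (fun x y hxy => Or.inl hxy) _ _ h2)
    · have hqp : Relation.ReflTransGen (fun x y => R x y ∨ Z₁.Joins f x y) (Z₁.snd f) (Z₁.fst f) :=
        Relation.ReflTransGen.single (Or.inr (Or.inr ⟨rfl, rfl⟩))
      exact ((Relation.ReflTransGen.mono (fun x y hxy => Or.inl hxy) _ _ h1).trans hqp).trans
        (Relation.ReflTransGen.mono (fun x y hxy => Or.inl hxy) _ _ h2)

variable [DecidableEq E₁]

/-- Red connectivity under the contraction of `f`, exactly: under the deletion, or through `f` in one direction. -/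
theorem RdS_double_iff_edge (st : E₁ → EStat) (f : E₁) (ω : E₁ → Bool) (a b : V₁) :
    RdS Z₁ (Function.update st f .double) ω a b ↔
      RdS Z₁ (Function.update st f .absent) ω a b ∨
        (RdS Z₁ (Function.update st f .absent) ω a (Z₁.fst f) ∧
          RdS Z₁ (Function.update st f .absent) ω (Z₁.snd f) b) ∨
        (RdS Z₁ (Function.update st f .absent) ω a (Z₁.snd f) ∧
          RdS Z₁ (Function.update st f .absent) ω (Z₁.fst f) b) := by
  unfold RdS
  simp only [mem_reach_singleton]
  rw [← rtg_add_edge_iff]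
  constructor
  · intro h
    exact Relation.ReflTransGen.mono (fun x y hxy => (RAdjS_double_iff Z₁ st f ω x y).mp hxy) a b h
  · intro h
    exact Relation.ReflTransGen.mono (fun x y hxy => (RAdjS_double_iff Z₁ st f ω x y).mpr hxy) a b h

/-- Blue connectivity under the contraction of `f`, exactly. -/
theorem MgS_double_iff_edge (st : E₁ → EStat) (f : E₁) (ω : E₁ → Bool) (a b : V₁) :
    MgS Z₁ (Function.update st f .double) ω a b ↔
      MgS Z₁ (Function.update st f .absent) ω a b ∨
        (MgS Z₁ (Function.update st f .absent) ω a (Z₁.fst f) ∧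
          MgS Z₁ (Function.update st f .absent) ω (Z₁.snd f) b) ∨
        (MgS Z₁ (Function.update st f .absent) ω a (Z₁.snd f) ∧
          MgS Z₁ (Function.update st f .absent) ω (Z₁.fst f) b) := by
  unfold MgS
  simp only [mem_reach_singleton]
  rw [← rtg_add_edge_iff]
  constructor
  · intro h
    exact Relation.ReflTransGen.mono (fun x y hxy => (BAdjS_double_iff Z₁ st f ω x y).mp hxy) a b h
  · intro h
    exact Relation.ReflTransGen.mono (fun x y hxy => (BAdjS_double_iff Z₁ st f ω x y).mpr hxy) a b h

omit [DecidableEq E₁] in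
/-- Every vertex is red-connected to itself. -/
theorem RdS_refl' (st : E₁ → EStat) (ω : E₁ → Bool) (k : V₁) : RdS Z₁ st ω k k := mem_reach_self _ _

omit [DecidableEq E₁] in
/-- Every vertex is blue-connected to itself. -/
theorem MgS_refl' (st : E₁ → EStat) (ω : E₁ → Bool) (k : V₁) : MgS Z₁ st ω k k := mem_reach_self _ _

/-! ## The patterns of the contraction of a mark edge -/

open Classical in
/-- Contracting a free edge `x–y`: the red pattern is the deletion's with `x` and `y` joined. -/
theorem rsig_double_join_xy {st : E₁ → EStat} {e : E₁} (hj : Z₁.Joins e a₁ u)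
    (ω : E₁ → Bool) :
    rsig Z₁ u u' a₁ (Function.update st e .double) ω =
      joinXY (rsig Z₁ u u' a₁ (Function.update st e .absent) ω) := by
  have hxy : RdS Z₁ (Function.update st e .double) ω a₁ u := by
    unfold RdS
    rw [mem_reach_singleton]
    exact Relation.ReflTransGen.single ⟨e, hj, by simp [redE]⟩
  have hxz : RdS Z₁ (Function.update st e .double) ω a₁ u' ↔
      RdS Z₁ (Function.update st e .absent) ω a₁ u' ∨ RdS Z₁ (Function.update st e .absent) ω u u' := by
    rw [RdS_double_iff_edge]
    rcases hj with ⟨h1, h2⟩ | ⟨h1, h2⟩ <;> rw [h1, h2]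
    · constructor
      · rintro (h | ⟨_, h⟩ | ⟨_, h⟩)
        exacts [Or.inl h, Or.inr h, Or.inl h]
      · rintro (h | h)
        · exact Or.inl h
        · exact Or.inr (Or.inl ⟨RdS_refl' Z₁ _ ω a₁, h⟩)
    · constructor
      · rintro (h | ⟨_, h⟩ | ⟨_, h⟩)
        exacts [Or.inl h, Or.inl h, Or.inr h]
      · rintro (h | h)
        · exact Or.inl h
        · exact Or.inr (Or.inr ⟨RdS_refl' Z₁ _ ω a₁, h⟩)
  have hyz : RdS Z₁ (Function.update st e .double) ω u u' ↔
      RdS Z₁ (Function.update st e .absent) ω a₁ u' ∨ RdS Z₁ (Function.update st e .absent) ω u u' := by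
    rw [RdS_double_iff_edge]
    rcases hj with ⟨h1, h2⟩ | ⟨h1, h2⟩ <;> rw [h1, h2]
    · constructor
      · rintro (h | ⟨_, h⟩ | ⟨_, h⟩)
        exacts [Or.inr h, Or.inr h, Or.inl h]
      · rintro (h | h)
        · exact Or.inr (Or.inr ⟨RdS_refl' Z₁ _ ω u, h⟩)
        · exact Or.inl h
    · constructor
      · rintro (h | ⟨_, h⟩ | ⟨_, h⟩)
        exacts [Or.inr h, Or.inl h, Or.inr h]
      · rintro (h | h)
        · exact Or.inr (Or.inl ⟨RdS_refl' Z₁ _ ω u, h⟩)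
        · exact Or.inl h
  simp only [rsig, joinXY, Prod.mk.injEq]
  refine ⟨decide_eq_true hxy, ?_, ?_⟩
  · by_cases h1 : RdS Z₁ (Function.update st e .absent) ω a₁ u' <;>
      by_cases h2 : RdS Z₁ (Function.update st e .absent) ω u u' <;> simp [hxz, h1, h2]
  · by_cases h1 : RdS Z₁ (Function.update st e .absent) ω a₁ u' <;>
      by_cases h2 : RdS Z₁ (Function.update st e .absent) ω u u' <;> simp [hyz, h1, h2]

open Classical in
/-- Contracting a free edge `x–y`: the blue pattern is the deletion's with `x` and `y` joined. -/
theorem bsig_double_join_xy {st : E₁ → EStat} {e : E₁} (hj : Z₁.Joins e a₁ u)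
    (ω : E₁ → Bool) :
    bsig Z₁ u u' a₁ (Function.update st e .double) ω =
      joinXY (bsig Z₁ u u' a₁ (Function.update st e .absent) ω) := by
  have hxy : MgS Z₁ (Function.update st e .double) ω a₁ u := by
    unfold MgS
    rw [mem_reach_singleton]
    exact Relation.ReflTransGen.single ⟨e, hj, by simp [blueE]⟩
  have hxz : MgS Z₁ (Function.update st e .double) ω a₁ u' ↔
      MgS Z₁ (Function.update st e .absent) ω a₁ u' ∨ MgS Z₁ (Function.update st e .absent) ω u u' := by
    rw [MgS_double_iff_edge]
    rcases hj with ⟨h1, h2⟩ | ⟨h1, h2⟩ <;> rw [h1, h2]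
    · constructor
      · rintro (h | ⟨_, h⟩ | ⟨_, h⟩)
        exacts [Or.inl h, Or.inr h, Or.inl h]
      · rintro (h | h)
        · exact Or.inl h
        · exact Or.inr (Or.inl ⟨MgS_refl' Z₁ _ ω a₁, h⟩)
    · constructor
      · rintro (h | ⟨_, h⟩ | ⟨_, h⟩)
        exacts [Or.inl h, Or.inl h, Or.inr h]
      · rintro (h | h)
        · exact Or.inl h
        · exact Or.inr (Or.inr ⟨MgS_refl' Z₁ _ ω a₁, h⟩)
  have hyz : MgS Z₁ (Function.update st e .double) ω u u' ↔
      MgS Z₁ (Function.update st e .absent) ω a₁ u' ∨ MgS Z₁ (Function.update st e .absent) ω u u' := by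
    rw [MgS_double_iff_edge]
    rcases hj with ⟨h1, h2⟩ | ⟨h1, h2⟩ <;> rw [h1, h2]
    · constructor
      · rintro (h | ⟨_, h⟩ | ⟨_, h⟩)
        exacts [Or.inr h, Or.inr h, Or.inl h]
      · rintro (h | h)
        · exact Or.inr (Or.inr ⟨MgS_refl' Z₁ _ ω u, h⟩)
        · exact Or.inl h
    · constructor
      · rintro (h | ⟨_, h⟩ | ⟨_, h⟩)
        exacts [Or.inr h, Or.inl h, Or.inr h]
      · rintro (h | h)
        · exact Or.inr (Or.inl ⟨MgS_refl' Z₁ _ ω u, h⟩)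
        · exact Or.inl h
  simp only [bsig, joinXY, Prod.mk.injEq]
  refine ⟨decide_eq_true hxy, ?_, ?_⟩
  · by_cases h1 : MgS Z₁ (Function.update st e .absent) ω a₁ u' <;>
      by_cases h2 : MgS Z₁ (Function.update st e .absent) ω u u' <;> simp [hxz, h1, h2]
  · by_cases h1 : MgS Z₁ (Function.update st e .absent) ω a₁ u' <;>
      by_cases h2 : MgS Z₁ (Function.update st e .absent) ω u u' <;> simp [hyz, h1, h2]

/-! ## The count of the conjecture's functional -/

variable [Fintype E₁]

open Classical in
/-- A sum of differences of indicators over a family is the difference of two cardinalities. -/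
theorem sum_ite_sub_eq_card_sub (V A B : (E₁ → Bool) → Prop) :
    (∑ ω : E₁ → Bool, if V ω then ((if A ω then (1 : ℤ) else 0) - (if B ω then 1 else 0)) else 0) =
      ((univ.filter fun ω : E₁ → Bool => V ω ∧ A ω).card : ℤ)
        - (univ.filter fun ω : E₁ → Bool => V ω ∧ B ω).card := by
  rw [Finset.card_filter, Finset.card_filter]
  push_cast
  rw [← Finset.sum_sub_distrib]
  refine Finset.sum_congr rfl fun ω _ => ?_
  by_cases hv : V ω <;> by_cases ha : A ω <;> by_cases hb : B ω <;> simp [hv, ha, hb]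

open Classical in
/-- The count of the conjecture's functional is `#(V ∩ (⊤,⊥)) − #(V ∩ crossed)`. -/
theorem cntF_cycF_eq (st : E₁ → EStat) (V : (E₁ → Bool) → Prop) :
    cntF Z₁ u u' a₁ CycF st V =
      ((univ.filter fun ω : E₁ → Bool => V ω ∧ TopBotS Z₁ a₁ u u' st ω).card : ℤ)
        - (univ.filter fun ω : E₁ → Bool => V ω ∧ CycCrossedS Z₁ a₁ u u' st ω).card := by
  rw [← sum_ite_sub_eq_card_sub]
  unfold cntF
  refine Finset.sum_congr rfl fun ω _ => ?_
  by_cases hv : V ω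
  · by_cases ht : TopBotS Z₁ a₁ u u' st ω <;> by_cases hc : CycCrossedS Z₁ a₁ u u' st ω <;>
      simp only [TopBotS, CycCrossedS] at ht hc <;> simp [CycF, TopBotS, CycCrossedS, hv, ht, hc]
  · simp [hv]

/-! ## THEOREM (ONE MARK EDGE) -/

open Classical in
/-- A free edge `x–y`: CONJECTURE (STOCHASTIC DOMINATION) on the status, from S1 on the deletion of the edge. -/
theorem cycDominationS_of_free_edge_xy {st : E₁ → EStat} {e : E₁} (he : st e = .free) (hj : Z₁.Joins e a₁ u) :
    CycDominationS Z₁ a₁ u u' st := by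
  intro V hV
  have hrec := cntF_rec Z₁ u u' a₁ CycF st e he V
  have hS1 := cntS1_nonneg Z₁ u u' a₁ (Function.update st e .absent) (upSet_sliceV hV e true)
  have hpt : ∀ ω : E₁ → Bool,
      (if sliceV V e true ω then
          S1F (rsig Z₁ u u' a₁ (Function.update st e .absent) ω) (bsig Z₁ u u' a₁ (Function.update st e .absent) ω)
        else 0) ≤
      (if sliceV V e true ω then
          CycF (rsig Z₁ u u' a₁ (Function.update st e .double) ω) (bsig Z₁ u u' a₁ (Function.update st e .absent) ω)
        else 0)
        + (if sliceV V e false ω then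
            CycF (rsig Z₁ u u' a₁ (Function.update st e .absent) ω)
              (bsig Z₁ u u' a₁ (Function.update st e .double) ω)
          else 0) := by
    intro ω
    rw [rsig_double_join_xy Z₁ u u' a₁ hj ω, bsig_double_join_xy Z₁ u u' a₁ hj ω]
    have hle := S1F_le_cycF_join _ _ (trans3_rsig Z₁ u u' a₁ (Function.update st e .absent) ω)
      (trans3_bsig Z₁ u u' a₁ (Function.update st e .absent) ω)
    have hnp := cycF_nonpos_of_blue_xy (rsig Z₁ u u' a₁ (Function.update st e .absent) ω)
      (joinXY (bsig Z₁ u u' a₁ (Function.update st e .absent) ω)) rfl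
    by_cases ha : sliceV V e true ω <;> by_cases hb : sliceV V e false ω
    · simp only [ha, hb, ↓reduceIte]; exact hle
    · simp only [ha, hb, ↓reduceIte, add_zero]; linarith
    · exact absurd (sliceV_false_le hV e ω hb) ha
    · simp only [ha, hb, ↓reduceIte, add_zero, le_refl]
  have hsum : cntS1 Z₁ u u' a₁ (Function.update st e .absent) (sliceV V e true) ≤
      (∑ ω : E₁ → Bool, if sliceV V e true ω then
          CycF (rsig Z₁ u u' a₁ (Function.update st e .double) ω) (bsig Z₁ u u' a₁ (Function.update st e .absent) ω)
        else 0)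
        + ∑ ω : E₁ → Bool, if sliceV V e false ω then
            CycF (rsig Z₁ u u' a₁ (Function.update st e .absent) ω)
              (bsig Z₁ u u' a₁ (Function.update st e .double) ω)
          else 0 := by
    unfold cntS1 cntF
    rw [← Finset.sum_add_distrib]
    exact Finset.sum_le_sum fun ω _ => hpt ω
  have h0 : 0 ≤ cntF Z₁ u u' a₁ CycF st V := by linarith
  rw [cntF_cycF_eq] at h0
  exact_mod_cast sub_nonneg.mp h0

omit [DecidableEq E₁] [Fintype E₁] in
/-- A double edge `x–y` joins `x` and `y` in both colours and empties every crossed class. -/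
theorem not_cycCrossedS_of_double_edge_xy {st : E₁ → EStat} {e : E₁} (he : st e = .double)
    (hj : Z₁.Joins e a₁ u) (ω : E₁ → Bool) : ¬ CycCrossedS Z₁ a₁ u u' st ω := by
  intro h
  have hr : RdS Z₁ st ω a₁ u := by
    unfold RdS
    rw [mem_reach_singleton]
    exact Relation.ReflTransGen.single ⟨e, hj, Or.inl he⟩
  have hb : MgS Z₁ st ω a₁ u := by
    unfold MgS
    rw [mem_reach_singleton]
    exact Relation.ReflTransGen.single ⟨e, hj, Or.inl he⟩
  rw [cycCrossedS_iff] at h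
  rcases h with ⟨_, ⟨h4, _⟩⟩ | ⟨⟨h1, _⟩, _⟩ | ⟨⟨h1, _⟩, _⟩
  · exact h4 hb
  · exact h1 hr
  · exact h1 hr

open Classical in
/-- A double edge `x–y`: the crossed classes are empty, the conjecture is trivial. -/
theorem cycDominationS_of_double_edge_xy {st : E₁ → EStat} {e : E₁} (he : st e = .double)
    (hj : Z₁.Joins e a₁ u) : CycDominationS Z₁ a₁ u u' st := by
  intro V _
  have h : (univ.filter fun ω : E₁ → Bool => V ω ∧ CycCrossedS Z₁ a₁ u u' st ω) = ∅ := by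
    ext ω
    simp [not_cycCrossedS_of_double_edge_xy Z₁ u u' a₁ he hj ω]
  rw [h, Finset.card_empty]
  exact Nat.zero_le _

open Classical in
/-- A present edge `x–y` (the anchor and the first exit): CONJECTURE (STOCHASTIC DOMINATION) holds on the status. -/
theorem cycDominationS_of_markEdge_xy {st : E₁ → EStat} {e : E₁} (he : presE st e) (hj : Z₁.Joins e a₁ u) :
    CycDominationS Z₁ a₁ u u' st := by
  unfold presE at he
  cases hst : st e with
  | free => exact cycDominationS_of_free_edge_xy Z₁ u u' a₁ hst hj
  | absent => exact absurd hst he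
  | double => exact cycDominationS_of_double_edge_xy Z₁ u u' a₁ hst hj

open Classical in
/-- **THEOREM (ONE MARK EDGE)**: on every status with a present edge joining two of the three marks `x, y, z`,
CONJECTURE (STOCHASTIC DOMINATION) holds (the pairs `xz` and `yz` by the rotation of the marks). -/
theorem cycDominationS_of_markEdge (st : E₁ → EStat) (x y z : V₁) {e : E₁} (he : presE st e)
    (hj : Z₁.Joins e x y ∨ Z₁.Joins e x z ∨ Z₁.Joins e y z) : CycDominationS Z₁ x y z st := by
  rcases hj with hj | hj | hj
  · exact cycDominationS_of_markEdge_xy Z₁ y z x he hj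
  · rw [cycDominationS_rot Z₁ st x y z, cycDominationS_rot Z₁ st y z x]
    exact cycDominationS_of_markEdge_xy Z₁ x y z he (Joins_symm Z₁ hj)
  · rw [cycDominationS_rot Z₁ st x y z]
    exact cycDominationS_of_markEdge_xy Z₁ z x y he hj

open Classical in
/-- **THEOREM (ONE MARK EDGE)**, all-free form: a finite host with an edge joining two of its three marks satisfies
CONJECTURE (STOCHASTIC DOMINATION). -/
theorem cycDomination_of_markEdge (x y z : V₁) (e : E₁)
    (hj : Z₁.Joins e x y ∨ Z₁.Joins e x z ∨ Z₁.Joins e y z) : CycDomination Z₁ x y z :=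
  (cycDominationS_free Z₁ x y z).mp
    (cycDominationS_of_markEdge Z₁ (fun _ => EStat.free) x y z (e := e) (by simp [presE]) hj)

end MultiExit

end ZoneZ

end PercRepro
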